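import Summits.QuantumFields.YangMills.Theorems.UnitScaleTiltProp7LemmaHCurvedOfLocalModels
import Summits.QuantumFields.YangMills.Theorems.UnitScaleTiltProp7ZetaRowOfEngineRows
import HarnessLib

/-!
# Route `UnitScaleTilt`, crux K1 child «MinimiserStabilityRegPr» (stmt-QuantumFields-19200) — route-R E′, S3 K-form engine, ROW (H) of the R5 door ✓`Prop7ZetaRowOfEngineRows`:
# «ROW (H) KNIT» — LEMMA-H-CURVED BOOKED ⇐ ✓`lemmaH_curved_of_localModels` + THREE DISPLAYED ROWS AT LOCAL-MODEL LEVEL (hRes, hDir, hGJ), generic local models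

Cell `ym3-torus` ∕ fleet seat `ym-ust-19200-p1` (gen 16, route-R E′ lead ∕ namer; NAMER WORD 2 (c) 2026-08-28 23:16Z «(H)'s displayed analytic rows are stated at local-model level»).
THEOREMS ONLY (0 `def`, 0 `sorry`); `--supports stmt-QuantumFields-19200`, count-neutral.  YM₃ on T³ is a ladder rung (R3), not the Clay problem; nothing here claims the stub,
the crux, d = 4 or the mass gap; row (H) is NOT closed by this file — hRes ∕ hDir ∕ hGJ are DISPLAYED.

WHY.  Row (H) of the engine door ✓p677112 is `Σ_x|D*_W D_Wφ₀|²_HS ≤ C_H·ℓ⁻¹·δ^V(φ₀) + ζ_H·K + θ_H·e·ℓ⁻²·M`.  Its raw inhabitant is routeR-w1's LEMMA-H-CURVED with FREE LOCAL MODELS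
✓`Prop7LemmaHCurvedOfLocalModels.lemmaH_curved_of_localModels`: for ANY local models `Ψ_y` of the centre data (`Ψ_y(c_y) = φ₀(c_y)`) and ANY interpolation data row
`‖Ψ_y(z) − Z_μ(z)‖ ≤ G_y` on the support predicate `N y z`, `ℓ·DIV(φ₀) ≤ ℓ·2·(3·LAP(Ψ) + c_D(ℓ)·DIR(Ψ) + c_G(ℓ)·Σ_y G_y²)` (at d = 3: `2c_D = 648ℓ⁻²`, `2c_G ≈ 1.79·10⁷ℓ⁻¹`).
The ℓ-power audit of the namer (bus 23:16Z) showed that expanding `DIR(Ψ)` for the transported-constant family into the sup-weighted commutator letters of ✓p675776∕✓p676852 loses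
the h-averaging benefit (one power of `ℓ`); so the engine DISPLAYS the three analytic inputs of (H) at the local-model level, for SOME local models (the supplier's choice —
of record: the h-averaged offset-comb `W`-transport of `φ₀(c_y)`, for which `D_WΨ_y = [hol, φ₀(c_y)]` is commutator currency, vanishing on aligned data):
  hRes `6·LAP(Ψ) ≤ ζ_R·K + θ_R·e·ℓ⁻²·M`,  hDir `2c_D(ℓ)·DIR(Ψ) ≤ ζ_D·K + θ_D·e·ℓ⁻²·M`,  hGJ (the junction with `δ^V`) `2c_G(ℓ)·Σ_y G_y² ≤ C_H·ℓ⁻¹·δV + ζ_G·K + θ_G·e·ℓ⁻²·M`,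
with `K`, `M`, `δV`, `e` ARBITRARY REALS here (at the door: the four-term `ℒ_p` energy and bond mass of the chart, `δ^V(φ₀)`, the radius).  Then (H) holds with `ζ_H = ζ_R + ζ_D + ζ_G`,
`θ_H = θ_R + θ_D + θ_G`.  Numerics owed: (N3) columns `ρ_Res`, `ρ_Dir`, `ρ_GJ` at constrained critical points (px8 g3).

WHAT IS PROVED (ns `…Theorems.Prop7RowHOfLocalModelRows`): ★ `covLapLap_eq_zero_of_split` (the door's `S_H` letter ⇒ LEMMA-H's `hψ` letter for the Hodge potential),
★★★ `rowH_of_localModelRows` (letters of ✓`lemmaH_curved_of_localModels` VERBATIM: support predicate, `LAP`, `DIR`,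
coefficients `c_D(ℓ) = 3(2d·6∕ℓ)(3∕ℓ)`, `c_G(ℓ) = 3d²(24∕ℓ)²((24∕ℓ)²ℓ^d)`).
HONEST SCOPE.  Bookkeeping over one landed theorem; the three rows are DISPLAYED, not proved; no constant of Bałaban's is asserted.

References: T. Bałaban, CMP 99 (1985) 389–434 [Balaban1985BackgroundPropagators] ((3.3)–(3.4) pp.390–391, (3.8) p.392, Thm 3.11 p.416); CMP 95 (1984) 17–40
[Balaban1984PropagatorsI] ((1.18) p.20, (1.29)–(1.31) p.23, Prop. 1.1 (1.90) p.33); CMP 102 (1985) 277–309 [Balaban1985Variational] (Prop. 7 p.299, (141)–(143)).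
-/

set_option autoImplicit false

noncomputable section

open scoped BigOperators Matrix.Norms.L2Operator Matrix

namespace Summit.QuantumFields.YangMills.Theorems.Prop7RowHOfLocalModelRows

open Literature.MathematicalPhysics.QuantumFieldTheory.Balaban1983to89
open Literature.MathematicalPhysics.QuantumFieldTheory.Balaban1983to89.T3ContinuumYM3Torus
open B9Eq39Adjoint (R covD covDstar divB covD_smul)
open B9TorusCalculus (torusT)
open B10Eq27TorusAxialLog (unitsField toUField)
open B5Eq118OneStroke (iterBlockOf)
open B15DeterminingSets (embIter)
open Summit.QuantumFields.YangMills.Theorems.Prop7LemmaHCurvedOfLocalModels (lemmaH_curved_of_localModels)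
open Summit.QuantumFields.YangMills.Theorems.Prop7ZetaRowOfEngineRows (div_chart_eq_covLap_of_split)
open Summit.QuantumFields.YangMills.Theorems.Prop7CovLaplaceSpectralSplit (divB_smul)

/-! ## §1 The `S_H` hypothesis of the door is the biharmonic hypothesis of LEMMA-H for the Hodge potential -/

section SH

variable {P : Params} {i : ℕ} {N : ℕ} (U : Fin P.d → Site P i → (Matrix (Fin N) (Fin N) ℂ)ˣ)

/-- ★ **`S_H` ⇒ `Δ_U(Δ_Uφ₀) = 0` OFF THE CENTRES.**  For a co-closed covariant Hodge split `D = B + D_Uφ₀`, `D*_UB = 0`, at any site `x`: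
`Δ_U(D*_U(i·D))(x) = 0 ⇒ Δ_U(Δ_Uφ₀)(x) = 0` (the door's `S_H` letter ⇒ the `hψ` letter of ✓`lemmaH_curved_of_localModels`).
[cite: Balaban1984PropagatorsI, (1.21) p.21; Balaban1985BackgroundPropagators, (3.3) p.390, (3.8) p.392] -/
theorem covLapLap_eq_zero_of_split (D B : PBond P i → Matrix (Fin N) (Fin N) ℂ) (φ₀ : Site P i → Matrix (Fin N) (Fin N) ℂ)
    (hsplit : ∀ b : PBond P i, D b = B b + covD (torusT P i) U b.dir φ₀ b.src)
    (hB : ∀ x : Site P i, divB (torusT P i) U (fun κ z => B ⟨z, κ⟩) x = 0) (x : Site P i)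
    (hSH : divB (torusT P i) U (fun μ z => covD (torusT P i) U μ
        (fun y => divB (torusT P i) U (fun κ z => Complex.I • D ⟨z, κ⟩) y) z) x = 0) :
    divB (torusT P i) U (fun κ y => covD (torusT P i) U κ
        (fun z => divB (torusT P i) U (fun ν w => covD (torusT P i) U ν φ₀ w) z) y) x = 0 := by
  have h1 : (fun y => divB (torusT P i) U (fun κ z => Complex.I • D ⟨z, κ⟩) y)
      = Complex.I • (fun z => divB (torusT P i) U (fun ν w => covD (torusT P i) U ν φ₀ w) z) := by
    funext y; exact div_chart_eq_covLap_of_split U D B φ₀ hsplit hB y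
  have h2 : (fun μ z => covD (torusT P i) U μ (fun y => divB (torusT P i) U (fun κ z => Complex.I • D ⟨z, κ⟩) y) z)
      = fun μ z => Complex.I • covD (torusT P i) U μ (fun z => divB (torusT P i) U (fun ν w => covD (torusT P i) U ν φ₀ w) z) z := by
    funext μ z; rw [h1, covD_smul]
  rw [h2, divB_smul] at hSH
  exact (smul_eq_zero.mp hSH).resolve_left Complex.I_ne_zero

end SH

/-! ## §2 ★★★ Row (H) from LEMMA-H-CURVED with free local models and the three displayed rows -/

set_option maxHeartbeats 800000 in
/-- ★★★ **ROW (H) OF THE ENGINE DOOR ⇐ LEMMA-H-CURVED WITH FREE LOCAL MODELS + hRes + hDir + hGJ.**  Run `K`, height `n` (`K − n ≤ m + K`, `ℓ = L^(K−n) ≥ 2`), `SU(2)` background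
`W`, a site field `ψ` with `Δ_W(Δ_Wψ) = 0` off the `(K−n)`-centres (the Hodge potential of an exactly `S_H`-gauged chart), reals `K M δV e C_H ζ_R θ_R ζ_D θ_D ζ_G θ_G`.  IF there
are local models `Ψ_y` interpolating `ψ` at the centres, recentring data `Z`, `G` with the data row of ✓`lemmaH_curved_of_localModels`, AND the three displayed rows
hRes `6·LAP(Ψ) ≤ ζ_R·K + θ_R·e·ℓ⁻²·M`, hDir `2·c_D(ℓ)·DIR(Ψ) ≤ ζ_D·K + θ_D·e·ℓ⁻²·M`, hGJ `2·c_G(ℓ)·Σ_y G_y² ≤ C_H·ℓ⁻¹·δV + ζ_G·K + θ_G·e·ℓ⁻²·M`, THEN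
`Σ_x|D*_W D_Wψ(x)|²_HS ≤ C_H·ℓ⁻¹·δV + (ζ_R + ζ_D + ζ_G)·K + (θ_R + θ_D + θ_G)·e·ℓ⁻²·M` — row (H) of ✓`Prop7ZetaRowOfEngineRows.zetaRow_of_engineRows`.
[cite: Balaban1985BackgroundPropagators, (3.3)-(3.4) pp.390-391, Thm 3.11 p.416; Balaban1984PropagatorsI, Prop. 1.1 (1.90) p.33; Balaban1985Variational, Prop. 7 p.299] -/
theorem rowH_of_localModelRows (F : T3Family) (K n : ℕ) (hk : K - n ≤ (F.P K).m + (F.P K).K) (hℓ2 : 2 ≤ (F.P K).L ^ (K - n))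
    (W : GaugeField (F.P K) 0 (Matrix.specialUnitaryGroup (Fin 2) ℂ)) (ψ : Site (F.P K) 0 → Matrix (Fin 2) (Fin 2) ℂ)
    (hψ : ∀ x : Site (F.P K) 0, x ∉ Set.range (embIter (K - n)) →
      divB (torusT (F.P K) 0) (fun κ z => unitsField (toUField W) ⟨z, κ⟩) (fun κ y => covD (torusT (F.P K) 0) (fun κ z => unitsField (toUField W) ⟨z, κ⟩) κ
        (fun z => divB (torusT (F.P K) 0) (fun κ z => unitsField (toUField W) ⟨z, κ⟩)
          (fun ν w => covD (torusT (F.P K) 0) (fun κ z => unitsField (toUField W) ⟨z, κ⟩) ν ψ w) z) y) x = 0)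
    {Kr Mr δV e C_H ζ_R θ_R ζ_D θ_D ζ_G θ_G : ℝ}
    (hrows : ∃ (Ψ : Site (F.P K) (K - n) → Site (F.P K) 0 → Matrix (Fin 2) (Fin 2) ℂ)
        (Z : Fin (F.P K).d → Site (F.P K) 0 → Matrix (Fin 2) (Fin 2) ℂ) (G : Site (F.P K) (K - n) → ℝ),
      (∀ y, Ψ y (embIter (K - n) y) = ψ (embIter (K - n) y)) ∧
      (∀ (y : Site (F.P K) (K - n)) (z : Site (F.P K) 0),
      (∀ ν : Fin (F.P K).d,
        (y ν = (iterBlockOf (K - n) (fun κ => z κ - (((((F.P K).L ^ (K - n) - 1) / 2 : ℕ)) : ZMod ((F.P K).sitesPerDir 0)))) ν - 1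
        ∨ y ν = (iterBlockOf (K - n) (fun κ => z κ - (((((F.P K).L ^ (K - n) - 1) / 2 : ℕ)) : ZMod ((F.P K).sitesPerDir 0)))) ν
        ∨ y ν = (iterBlockOf (K - n) (fun κ => z κ - (((((F.P K).L ^ (K - n) - 1) / 2 : ℕ)) : ZMod ((F.P K).sitesPerDir 0)))) ν + 1
        ∨ y ν = (iterBlockOf (K - n) (fun κ => z κ - (((((F.P K).L ^ (K - n) - 1) / 2 : ℕ)) : ZMod ((F.P K).sitesPerDir 0)))) ν + 2)) →
      ∀ μ : Fin (F.P K).d, ‖Ψ y z - Z μ z‖ ≤ G y) ∧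
      -- hRes: the Laplacian group of the local models
      6 * (∑ y : Site (F.P K) (K - n), ∑ z : Site (F.P K) 0,
            (if (∀ ν : Fin (F.P K).d,
                (y ν = (iterBlockOf (K - n) (fun κ => z κ - (((((F.P K).L ^ (K - n) - 1) / 2 : ℕ)) : ZMod ((F.P K).sitesPerDir 0)))) ν - 1
                ∨ y ν = (iterBlockOf (K - n) (fun κ => z κ - (((((F.P K).L ^ (K - n) - 1) / 2 : ℕ)) : ZMod ((F.P K).sitesPerDir 0)))) ν
                ∨ y ν = (iterBlockOf (K - n) (fun κ => z κ - (((((F.P K).L ^ (K - n) - 1) / 2 : ℕ)) : ZMod ((F.P K).sitesPerDir 0)))) ν + 1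
                ∨ y ν = (iterBlockOf (K - n) (fun κ => z κ - (((((F.P K).L ^ (K - n) - 1) / 2 : ℕ)) : ZMod ((F.P K).sitesPerDir 0)))) ν + 2))
              then ‖divB (torusT (F.P K) 0) (fun κ z => unitsField (toUField W) ⟨z, κ⟩)
                (fun μ => covD (torusT (F.P K) 0) (fun κ z => unitsField (toUField W) ⟨z, κ⟩) μ (Ψ y)) z‖ ^ 2 else 0))
        ≤ ζ_R * Kr + θ_R * e * (((F.L : ℝ) ^ (K - n)) ^ 2)⁻¹ * Mr ∧
      -- hDir: the supported covariant Dirichlet group of the local models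
      2 * (3 * (2 * ((F.P K).d : ℝ) * (6 / ((((F.P K).L ^ (K - n) : ℕ) : ℝ)))) * (3 / ((((F.P K).L ^ (K - n) : ℕ) : ℝ))))
          * (∑ y : Site (F.P K) (K - n), ∑ z : Site (F.P K) 0,
              (if (∀ ν : Fin (F.P K).d,
                  (y ν = (iterBlockOf (K - n) (fun κ => z κ - (((((F.P K).L ^ (K - n) - 1) / 2 : ℕ)) : ZMod ((F.P K).sitesPerDir 0)))) ν - 1
                  ∨ y ν = (iterBlockOf (K - n) (fun κ => z κ - (((((F.P K).L ^ (K - n) - 1) / 2 : ℕ)) : ZMod ((F.P K).sitesPerDir 0)))) ν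
                  ∨ y ν = (iterBlockOf (K - n) (fun κ => z κ - (((((F.P K).L ^ (K - n) - 1) / 2 : ℕ)) : ZMod ((F.P K).sitesPerDir 0)))) ν + 1
                  ∨ y ν = (iterBlockOf (K - n) (fun κ => z κ - (((((F.P K).L ^ (K - n) - 1) / 2 : ℕ)) : ZMod ((F.P K).sitesPerDir 0)))) ν + 2))
                then ∑ μ : Fin (F.P K).d,
                  (‖covDstar (torusT (F.P K) 0) (fun κ z => unitsField (toUField W) ⟨z, κ⟩) μ (Ψ y) z‖ ^ 2
                    + ‖covD (torusT (F.P K) 0) (fun κ z => unitsField (toUField W) ⟨z, κ⟩) μ (Ψ y) z‖ ^ 2) else 0))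
        ≤ ζ_D * Kr + θ_D * e * (((F.L : ℝ) ^ (K - n)) ^ 2)⁻¹ * Mr ∧
      -- hGJ: the interpolation-consistency group, booked against `δV` (the junction) and the currencies
      2 * (3 * ((F.P K).d : ℝ) ^ 2 * (24 / ((((F.P K).L ^ (K - n) : ℕ) : ℝ)) ^ 2)
            * (24 / ((((F.P K).L ^ (K - n) : ℕ) : ℝ)) ^ 2 * ((((F.P K).L ^ (K - n) : ℕ) : ℝ)) ^ (F.P K).d))
          * (∑ y : Site (F.P K) (K - n), G y ^ 2)
        ≤ C_H * ((F.L : ℝ) ^ (K - n))⁻¹ * δV + ζ_G * Kr + θ_G * e * (((F.L : ℝ) ^ (K - n)) ^ 2)⁻¹ * Mr) :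
    ∑ x : Site (F.P K) 0, ∑ a : Fin 2, ∑ b : Fin 2,
        Complex.normSq ((divB (torusT (F.P K) 0) (fun κ z => unitsField (toUField W) ⟨z, κ⟩)
          (fun κ y => covD (torusT (F.P K) 0) (fun κ z => unitsField (toUField W) ⟨z, κ⟩) κ ψ y) x) a b)
      ≤ C_H * ((F.L : ℝ) ^ (K - n))⁻¹ * δV + (ζ_R + ζ_D + ζ_G) * Kr + (θ_R + θ_D + θ_G) * e * (((F.L : ℝ) ^ (K - n)) ^ 2)⁻¹ * Mr := by
  obtain ⟨Ψ, Z, G, hΨ, hG, hRes, hDir, hGJ⟩ := hrows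
  have main := lemmaH_curved_of_localModels F K n hk hℓ2 W ψ hψ Ψ hΨ Z G hG
  have hL2 : (2 : ℝ) ≤ (F.L : ℝ) ^ (K - n) := by exact_mod_cast hℓ2.trans_eq (by rfl)
  have hℓ : (0 : ℝ) < (F.L : ℝ) ^ (K - n) := by linarith
  have h1 := le_of_mul_le_mul_left main hℓ
  linarith [h1, hRes, hDir, hGJ]

end Summit.QuantumFields.YangMills.Theorems.Prop7RowHOfLocalModelRows

end
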